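import Summits.Ventures.QEC.Census.CertCoverBatch
import Summits.Ventures.QEC.Census.BB.A1s_n168_k6_48810f7d.CoreDefs
import HarnessLib

set_option Elab.async false
set_option maxRecDepth 200000

/-!
# `[[168,6,16]]` one-level cover certificate of `A1s_n168_k6_48810f7d` — LEVEL-1→0 coset problems 209…235 (deep problems [6] excluded: `ProbDeep*.lean`) as COMPACT data
(`ProbData`: U, f, σ, y₀, allow; qec-type-10 `CertCoverBatch.mkCoset` rebuilds each `CosetProb` in the kernel) + their verdict
`probsOK cov covR hx hx1 D1 lxd 14` (one `decide +kernel`; 27 problems, depths f=0:24 f=1:3 f=2:0 f=3:0, est. 108.0 s).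
qec-search-1 g5 (pattern of search-9 g5 `Probs*`); data from JSON `level10.problems` (sha256 30ee1c0603955da8…). Data + decided check; KERNEL.
-/

namespace Summit.Ventures.QEC.Census.A1s_n168_k6_48810f7d

open Matrix Summit.Ventures.QEC.Census Literature.InformationTheory.QuantumCodes

/-- Problems 209…235 (27): `⟨U, f, σ, y₀, allow⟩`. -/
def probs04b : List ProbData := [
    ⟨20365502862149533304450, 0, 876177554832, 158402733540932, []⟩,
    ⟨20366367544481897645696, 0, 876174408960, 20365214464574644289732, []⟩,
    ⟨20383836902910123638784, 0, 294272910082, 1475780075886413045782, []⟩,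
    ⟨20385098472661455470592, 0, 335024235264, 20365206073119039029992, []⟩,
    ⟨20388557201990911787016, 0, 335011651904, 18447307055564195644, []⟩,
    ⟨20440438141932504875136, 0, 335091353344, 18890618905790470423512, []⟩,
    ⟨20443896871261944414344, 1, 335078769984, 18967864593819349943132, []⟩,
    ⟨20679234721928232330240, 0, 3040841212161, 20660787977579688894528, []⟩,
    ⟨22805080165473862025216, 1, 305013998592, 3837215501337553667036, []⟩,
    ⟨23031338699591057015809, 0, 466416083080, 21251225642479404744841, []⟩,
    ⟨29888701947388473917440, 0, 330784982016, 20148744444904299889256, []⟩,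
    ⟨39116906504954436386952, 0, 558488373568, 39107097524227328442528, []⟩,
    ⟨39259284219545562128930, 0, 120326213649, 38964135170874127557350, []⟩,
    ⟨41478089658428865642496, 1, 597143078912, 39107673897052389311830, []⟩,
    ⟨46200456035744320848144, 0, 657272621696, 2370415620708244980822, []⟩,
    ⟨48561711440343477534720, 0, 554194585600, 38960109092415718051680, []⟩,
    ⟨58222612614294618062848, 0, 433860527104, 38147866744449248414788, []⟩,
    ⟨67667273469646669414536, 0, 438154315072, 29814550109228133534096, []⟩,
    ⟨70028456763858587025408, 0, 476809020416, 1185207810404722493600, []⟩,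
    ⟨76757208494174852096320, 0, 4037273453312, 1180898023894805389312, []⟩,
    ⟨76757228038728477454532, 0, 1116713526819, 75576348187642160635950, []⟩,
    ⟨76758780391401340338177, 0, 1391630749960, 144397247479611659, []⟩,
    ⟨76813432407924341223494, 0, 1116775400115, 75559053802123114995886, []⟩,
    ⟨76814638325889303052624, 0, 1116700938113, 2323927778932359178, []⟩,
    ⟨76896410395575733780544, 0, 86117978880, 76895257456470949167184, []⟩,
    ⟨77006024351185201283136, 0, 1116860449537, 76858432384199405944922, []⟩,
    ⟨77042918965232510468928, 0, 1116726385409, 295168171379370656380, []⟩]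

set_option maxHeartbeats 400000000 in
/-- Every problem of this chunk passes (`mkCoset` elimination + `cosetOKD` + fast `σ` + depth + `BU`-evenness + label checks). -/
theorem probs04b_ok : probsOK A1s_n168_k6_48810f7d.cov covR hx hx1 D1 lxd 14 probs04b = true := by
  decide +kernel

/-- Pointwise form. -/
theorem probs04b_all : ∀ x ∈ probs04b, probOK A1s_n168_k6_48810f7d.cov covR hx hx1 D1 lxd 14 x = true := by
  have h := probs04b_ok
  rwa [probsOK, List.all_eq_true] at h

end Summit.Ventures.QEC.Census.A1s_n168_k6_48810f7d
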